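import Mathlib.Algebra.Group.Pointwise.Set.Basic
import Mathlib.Algebra.Order.Group.Pointwise.Interval
import Literature.AlgebraicGeometry.Frobenioids.ArchimedeanBaseCategory
import Literature.AlgebraicGeometry.Frobenioids.ArchimedeanData
import HarnessLib

/-!
# Frobenioids II, Example 3.3 (i): the category `C₀` of archimedean angular data

Mochizuki, *The geometry of Frobenioids II: poly-Frobenioids*, Kyushu J. Math. **62** (2008)
401–460, §3, Example 3.3 (i), author's text pp. 27–28 [cite: MochizukiFrdII2008, Ex 3.3 (i) pp.27-28].

The category `C₀`: objects are triples `(Spec K, V_K, A_K)` with `Spec K ∈ Ob(D₀)`, `V_K` a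
one-dimensional `K`-vector space and `A_K ⊆ V_K` an angular region; a morphism
`φ : (Spec L, V_L, A_L) → (Spec K, V_K, A_K)` consists of (a) `Base(φ) : Spec L → Spec K` in `D₀`,
(b) `deg_Fr(φ) = d ∈ ℕ_{≥1}`, (c) an isomorphism of `L`-vector spaces `V_L^{⊗d} ⥲ V_K|_L` mapping
`A_L^{⊗d}` into `A_K|_L`. `Div(φ) := log(λ) ∈ ℝ_{≥0}` for the largest `λ ∈ ℝ_{>0}` with
`λ · Im(A_L^{⊗d}) ⊆ A_K|_L`; `Φ₀ : D₀ → Mon`, `Spec K ↦ ord(K) ≅ ℝ_{>0} ≅ ℝ_{≥0}` (via `log`); "the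
triple `(Base(−), Div(−), deg_Fr(−))` determines a pre-Frobenioid structure `C₀ → F_{Φ₀}`".

**Rendering (documented deviation, up to equivalence of categories; see also
`ArchimedeanBaseCategory.lean`).** `D₀` is its skeleton `ArchFrd.D0`. We take `V_K := K` and read
everything inside `ℂ`: an object is a pair (`base : D0`, `region : ArchFrd.AngularRegion ℂ`)
where a *real* object `(Spec ℝ, ℝ, [-λ, λ] ∖ {0})` is recorded by the complexification of its region,
i.e. the isotropic region of tip `λ` (for `K = ℝ` the angular part `B = O_ℝ^×` is forced, Def. 3.1
(iii), so nothing is lost); an isomorphism `V_L^{⊗d} = L ⥲ V_K|_L = L` is multiplication by a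
scalar `c ∈ L^× ⊆ ℂ^×`, and `A_K|_L ⊆ V_K ⊗_{K,ι} L = ℂ` is the image of `A_K` under the field
embedding `ι : K ↪ L` (`Base(φ).act`, identity or complex conjugation; Def. 3.1 (iv)). Condition (c)
becomes `c • A_L ^ d ⊆ Base(φ).act '' A_K` (pointwise product of sets = `A_L^{⊗d}`), and
`Div(φ) = log( tip(A_K) / (|c| · tip(A_L)^d) )`. Every object of the printed `C₀` is isomorphic to
one of ours (choose a basis of `V_K`), so the printed category is equivalent to `ArchFrd.C0`.
The monoid `ℝ_{≥0}` is the tree's `Multiplicative ℝ≥0` (cf. `IsRMonoprime`, `Monoids.lean`).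

**Contents / claims (this file = objects, morphisms, the category).** `C0` with its `Category`
instance (laws PROVED: the composite of data (c) is
`(ψ ≫ φ).scalar = Base(ψ).act(φ.scalar) · ψ.scalar ^ deg_Fr(φ)`); base change `A_K|_L` with its
transitivity (PROVED); naive isotropy and naive co-angularity. Deliberately NOT here: `Div`, `Φ₀`
and the structure functor `C₀ → F_{Φ₀}` (companion file `ArchimedeanDivisors.lean`), the relative
category `C := C₀ ×_{D₀} D` and items (ii)–(v) of Example 3.3 (file `AngularFrobenioids.lean`).
-/

namespace Literature.AlgebraicGeometry.Frobenioids

open CategoryTheory Opposite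
open scoped Pointwise NNReal

noncomputable section

namespace ArchFrd

/-! ### Objects of `C₀` -/

/-- An object `(Spec K, V_K, A_K)` of `C₀` (FrdII Ex. 3.3 (i), p. 27), rendered with `V_K := K`
inside `ℂ`: a base `Spec K ∈ Ob(D₀)` and an angular region read in `ℂ^×`, isotropic when `K` is real
(the complexification of the real angular region `[-λ, λ] ∖ {0}`).
[cite: MochizukiFrdII2008, Ex 3.3 (i) p.27] -/
structure C0 : Type where
  /-- `Spec K ∈ Ob(D₀)` -/
  base : D0
  /-- the angular region `A_K ⊆ V_K` read inside `V_K ⊗_K ℂ = ℂ` -/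
  region : AngularRegion ℂ
  /-- for real `K` the angular part is all of `O_K^×` (Def. 3.1 (iii)), i.e. the region is isotropic -/
  isIsotropic_of_isReal : base = .real → region.IsIsotropic

namespace C0

variable {X Y Z : C0}

/-- "We shall say that the object `(Spec K, V_K, A_K)` is *naively isotropic* if `A_K` is isotropic"
(FrdII Ex. 3.3 (i), p. 27). [cite: MochizukiFrdII2008, Ex 3.3 (i) p.27] -/
def IsNaivelyIsotropic (X : C0) : Prop := X.region.IsIsotropic

/-- A *real* object: one over `Spec ℝ` (FrdII Def. 3.1 (v), p. 24). [cite: MochizukiFrdII2008, Def 3.1 (v) p.24] -/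
def IsRealObj (X : C0) : Prop := X.base.IsReal

/-- A *complex* object: one over `Spec ℂ` (FrdII Def. 3.1 (v), p. 24). [cite: MochizukiFrdII2008, Def 3.1 (v) p.24] -/
def IsComplexObj (X : C0) : Prop := X.base.IsComplex

/-- Real objects are naively isotropic ("`B = O_K^×` whenever `K` is real", Def. 3.1 (iii)).
[cite: MochizukiFrdII2008, Def 3.1 (iii) p.24] -/
theorem isNaivelyIsotropic_of_isRealObj (h : X.IsRealObj) : X.IsNaivelyIsotropic :=
  X.isIsotropic_of_isReal h

/-- The tip `λ ∈ ℝ_{>0}` of the angular region of an object, as a real number.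
[cite: MochizukiFrdII2008, Def 3.1 (iii) p.24] -/
def tip (X : C0) : ℝ := (X.region.tip : ℝ)

/-- Tips are positive. [cite: MochizukiFrdII2008, Def 3.1 (iii) p.24] -/
theorem tip_pos (X : C0) : 0 < X.tip := X.region.tip.2

/-- `A_K|_L ⊆ V_K ⊗_K L`: the base change of the angular region of `Y = (Spec K, V_K, A_K)` along
`f : Spec L → Spec K` (FrdII Def. 3.1 (iv), p. 24), read inside `ℂ^×` as the image of `A_K` under the
field embedding `K ↪ L`. [cite: MochizukiFrdII2008, Def 3.1 (iv) p.24] -/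
def pullRegion (Y : C0) {L : D0} (f : L ⟶ Y.base) : Set ℂˣ := f.act '' Y.region.carrier

/-- An isotropic region read in `ℂ^×` is the set of units of absolute value at most the tip.
[cite: MochizukiFrdII2008, Def 3.1 (iii) p.24] -/
theorem mem_carrier_of_isIsotropic {A : AngularRegion ℂ} (hA : A.IsIsotropic) (u : ℂˣ) :
    u ∈ A.carrier ↔ absHom ℂ u ≤ A.tip := by
  change unitPart ℂ u ∈ A.dir ∧ absHom ℂ u ≤ A.tip ↔ _
  rw [show A.dir = Set.univ from hA]
  simp

/-- The Galois twist preserves absolute values. [cite: MochizukiFrdII2008, Def 3.1 (ii) p.23] -/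
@[simp] theorem absHom_galAct (σ : Bool) (u : ℂˣ) :
    absHom ℂ (D0.galAct σ u) = absHom ℂ u :=
  Subtype.ext (by rw [coe_absHom, coe_absHom, D0.norm_galAct])

/-- An isotropic region is stable under the Galois twist ("[necessarily isotropic]", Def. 3.1 (iv)).
[cite: MochizukiFrdII2008, Def 3.1 (iv) p.24] -/
theorem image_galAct_of_isIsotropic {A : AngularRegion ℂ} (hA : A.IsIsotropic) (σ : Bool) :
    D0.galAct σ '' A.carrier = A.carrier := by
  ext x
  simp only [Set.mem_image, mem_carrier_of_isIsotropic hA]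
  constructor
  · rintro ⟨y, hy, rfl⟩
    rwa [absHom_galAct]
  · intro hx
    exact ⟨D0.galAct σ x, by rwa [absHom_galAct], D0.galAct_galAct σ x⟩

/-- Base change along the identity is the identity. [cite: MochizukiFrdII2008, Def 3.1 (iv) p.24] -/
@[simp] theorem pullRegion_id (Y : C0) : pullRegion Y (𝟙 Y.base) = Y.region.carrier := by
  unfold pullRegion D0.Hom.act
  rw [D0.twists_id, D0.image_galAct_false]

/-- Transitivity of base change: `A_K|_M = (A_K|_L)|_M` along `Spec M → Spec L → Spec K`.
[cite: MochizukiFrdII2008, Def 3.1 (iv) p.24] -/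
theorem pullRegion_comp {M L : D0} (f : M ⟶ L) (Z : C0) (g : L ⟶ Z.base) :
    pullRegion Z (f ≫ g) = f.act '' pullRegion Z g := by
  rcases Z with ⟨K, A, hA⟩
  unfold pullRegion D0.Hom.act
  dsimp only at g hA ⊢
  cases g with
  | idReal =>
    simp only [D0.twists_of_real, D0.image_galAct_false]
  | toReal =>
    cases f with
    | gal σ =>
      simp only [D0.twists_of_real, D0.twists_gal, image_galAct_of_isIsotropic (hA rfl)]
  | gal τ =>
    cases f with
    | gal σ =>
      rw [Set.image_image]
      refine Set.image_congr' fun u => ?_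
      simp only [D0.twists_comp_complex, D0.twists_gal]
      rw [D0.galAct_xor, D0.galAct_comm]

/-! ### Morphisms of `C₀` -/

/-- A morphism `φ : X = (Spec L, V_L, A_L) → Y = (Spec K, V_K, A_K)` of `C₀` (FrdII Ex. 3.3 (i),
p. 27): "(a) a morphism `Base(φ) : Spec(L) → Spec(K)` of `D₀`; (b) an element
`deg_Fr(φ) := d ∈ ℕ_{≥1}`; (c) an isomorphism of `L`-vector spaces `V_L^{⊗d} ⥲ V_K|_L` that maps
`A_L^{⊗d}` into `A_K|_L`" — with `V_L = L` the isomorphism (c) is multiplication by a scalar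
`c ∈ L^×`, and the condition reads `c · A_L^{⊗d} ⊆ A_K|_L` inside `ℂ^×`.
[cite: MochizukiFrdII2008, Ex 3.3 (i) p.27] -/
@[ext] structure Hom (X Y : C0) : Type where
  /-- (a) `Base(φ)` -/
  base : X.base ⟶ Y.base
  /-- (b) `deg_Fr(φ)` -/
  degFr : ℕ+
  /-- (c) the isomorphism `V_L^{⊗d} ⥲ V_K|_L`, as a scalar -/
  scalar : ℂˣ
  /-- the scalar lies in `L^×` -/
  scalar_mem : scalar ∈ D0.scalars X.base
  /-- (c) "maps `A_L^{⊗d}` into `A_K|_L`" -/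
  mapsTo : scalar • X.region.carrier ^ (degFr : ℕ) ⊆ pullRegion Y base

/-- `Im(A_L^{⊗d}) ⊆ V_K|_L`, the image of `A_L^{⊗d}` under the isomorphism (c)
(FrdII Ex. 3.3 (i), p. 28). [cite: MochizukiFrdII2008, Ex 3.3 (i) p.28] -/
def Hom.image (φ : Hom X Y) : Set ℂˣ := φ.scalar • X.region.carrier ^ (φ.degFr : ℕ)

/-- Pointwise: `(c • S)^n = c^n • S^n` in a commutative group. [cite: MochizukiFrdII2008, Ex 3.3 (i) p.27] -/
private theorem smul_set_pow (a : ℂˣ) (s : Set ℂˣ) (n : ℕ) : (a • s) ^ n = a ^ n • s ^ n := by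
  induction n with
  | zero => simp
  | succ n ih =>
    rw [pow_succ, ih, pow_succ, pow_succ]
    ext x
    simp only [Set.mem_mul, Set.mem_smul_set, smul_eq_mul]
    constructor
    · rintro ⟨_, ⟨y, hy, rfl⟩, _, ⟨z, hz, rfl⟩, rfl⟩
      exact ⟨y * z, ⟨y, hy, z, hz, rfl⟩, mul_mul_mul_comm _ _ _ _⟩
    · rintro ⟨_, ⟨y, hy, z, hz, rfl⟩, rfl⟩
      exact ⟨a ^ n * y, ⟨y, hy, rfl⟩, a * z, ⟨z, hz, rfl⟩, (mul_mul_mul_comm _ _ _ _).symm⟩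

/-- The scalar of an arrow out of `X` twisted along an arrow into `X` stays a scalar of the new
domain. [cite: MochizukiFrdII2008, Ex 3.3 (i) p.27] -/
theorem act_mem_scalars {M L : D0} (f : M ⟶ L) {u : ℂˣ} (hu : u ∈ D0.scalars L) :
    f.act u ∈ D0.scalars M := by
  cases f with
  | idReal => exact D0.galAct_mem_scalars _ hu
  | toReal => simp
  | gal σ => simp

/-- Twisting a scalar of `K` along a composite `Spec M → Spec L → Spec K` is twisting twice.
[cite: MochizukiFrdII2008, Def 3.1 (i) p.23] -/
theorem act_comp_of_mem {M L K : D0} (f : M ⟶ L) (g : L ⟶ K) {u : ℂˣ}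
    (hu : u ∈ D0.scalars K) : (f ≫ g).act u = f.act (g.act u) := by
  unfold D0.Hom.act
  cases g with
  | idReal => simp only [D0.twists_of_real, D0.galAct_false]
  | toReal =>
    cases f with
    | gal σ =>
      simp only [D0.twists_of_real, D0.twists_gal, D0.galAct_false]
      exact (D0.galAct_eq_self_of_mem_scalars_real σ hu).symm
  | gal τ =>
    cases f with
    | gal σ =>
      simp only [D0.twists_comp_complex, D0.twists_gal]
      rw [D0.galAct_xor, D0.galAct_comm]

/-- The identity of `C₀`: `(id, 1, 1)`. [cite: MochizukiFrdII2008, Ex 3.3 (i) p.27] -/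
def Hom.id (X : C0) : Hom X X where
  base := 𝟙 X.base
  degFr := 1
  scalar := 1
  scalar_mem := one_mem _
  mapsTo := by rw [one_smul, PNat.one_coe, pow_one, pullRegion_id]

/-- The composite of `ψ : X → Y` followed by `φ : Y → Z` (FrdII Ex. 3.3 (i), p. 27): bases and
Frobenius degrees compose, and the isomorphism (c) of the composite
`V_M^{⊗ d_ψ d_φ} = (V_M^{⊗ d_ψ})^{⊗ d_φ} ⥲ (V_L|_M)^{⊗ d_φ} = (V_L^{⊗ d_φ})|_M ⥲ (V_K|_L)|_M = V_K|_M` is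
multiplication by `Base(ψ).act(c_φ) · c_ψ^{d_φ}`. [cite: MochizukiFrdII2008, Ex 3.3 (i) p.27] -/
def Hom.comp (ψ : Hom X Y) (φ : Hom Y Z) : Hom X Z where
  base := ψ.base ≫ φ.base
  degFr := ψ.degFr * φ.degFr
  scalar := ψ.base.act φ.scalar * ψ.scalar ^ (φ.degFr : ℕ)
  scalar_mem := mul_mem (act_mem_scalars ψ.base φ.scalar_mem) (pow_mem ψ.scalar_mem _)
  mapsTo := by
    rw [pullRegion_comp, PNat.mul_coe, mul_smul, pow_mul, ← smul_set_pow]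
    refine (Set.smul_set_mono (Set.pow_subset_pow_left ψ.mapsTo)).trans ?_
    unfold pullRegion
    rw [← Set.image_pow, ← Set.image_smul_distrib]
    exact Set.image_mono φ.mapsTo

/-- `C₀` is a category (FrdII Ex. 3.3 (i), p. 27) — PROVED. [cite: MochizukiFrdII2008, Ex 3.3 (i) p.27] -/
instance instCategory : Category C0 where
  Hom := Hom
  id := Hom.id
  comp := Hom.comp
  id_comp φ := by
    refine Hom.ext (Category.id_comp _) (one_mul _) ?_
    change D0.Hom.act (𝟙 _) φ.scalar * 1 ^ (φ.degFr : ℕ) = φ.scalar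
    unfold D0.Hom.act
    rw [D0.twists_id, D0.galAct_false, one_pow, mul_one]
  comp_id φ := by
    refine Hom.ext (Category.comp_id _) (mul_one _) ?_
    change φ.base.act 1 * φ.scalar ^ ((1 : ℕ+) : ℕ) = φ.scalar
    rw [map_one, PNat.one_coe, pow_one, one_mul]
  assoc χ ψ φ := by
    refine Hom.ext (Category.assoc _ _ _) (mul_assoc _ _ _) ?_
    change (χ.base ≫ ψ.base).act φ.scalar * (χ.base.act ψ.scalar * χ.scalar ^ (ψ.degFr : ℕ)) ^ (φ.degFr : ℕ)
      = χ.base.act (ψ.base.act φ.scalar * ψ.scalar ^ (φ.degFr : ℕ)) *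
        χ.scalar ^ ((ψ.degFr * φ.degFr : ℕ+) : ℕ)
    rw [act_comp_of_mem _ _ φ.scalar_mem, map_mul, map_pow, mul_pow, ← pow_mul, PNat.mul_coe,
      mul_assoc]

/-- `Base(φ)` (FrdII Ex. 3.3 (i) (a), p. 27). [cite: MochizukiFrdII2008, Ex 3.3 (i) p.27] -/
abbrev Base (φ : X ⟶ Y) : X.base ⟶ Y.base := Hom.base φ

/-- `deg_Fr(φ)` (FrdII Ex. 3.3 (i) (b), p. 27). [cite: MochizukiFrdII2008, Ex 3.3 (i) p.27] -/
abbrev degFr (φ : X ⟶ Y) : ℕ+ := Hom.degFr φ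

/-- The scalar of the isomorphism (c) of `φ` (FrdII Ex. 3.3 (i) (c), p. 27).
[cite: MochizukiFrdII2008, Ex 3.3 (i) p.27] -/
abbrev scalar (φ : X ⟶ Y) : ℂˣ := Hom.scalar φ

/-- `Base(id) = id`. [cite: MochizukiFrdII2008, Ex 3.3 (i) p.27] -/
@[simp] theorem base_id' (X : C0) : Base (𝟙 X) = 𝟙 X.base := rfl

/-- `deg_Fr(id) = 1`. [cite: MochizukiFrdII2008, Ex 3.3 (i) p.27] -/
@[simp] theorem degFr_id' (X : C0) : degFr (𝟙 X) = 1 := rfl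

/-- The scalar of the identity is `1`. [cite: MochizukiFrdII2008, Ex 3.3 (i) p.27] -/
@[simp] theorem scalar_id' (X : C0) : scalar (𝟙 X) = 1 := rfl

/-- `Base(ψ ≫ φ) = Base(ψ) ≫ Base(φ)`. [cite: MochizukiFrdII2008, Ex 3.3 (i) p.27] -/
@[simp] theorem base_comp' (ψ : X ⟶ Y) (φ : Y ⟶ Z) : Base (ψ ≫ φ) = Base ψ ≫ Base φ := rfl

/-- `deg_Fr(ψ ≫ φ) = deg_Fr(ψ) · deg_Fr(φ)`. [cite: MochizukiFrdII2008, Ex 3.3 (i) p.27] -/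
@[simp] theorem degFr_comp' (ψ : X ⟶ Y) (φ : Y ⟶ Z) : degFr (ψ ≫ φ) = degFr ψ * degFr φ := rfl

/-- The scalar of a composite: `Base(ψ).act(c_φ) · c_ψ ^ deg_Fr(φ)`. [cite: MochizukiFrdII2008, Ex 3.3 (i) p.27] -/
@[simp] theorem scalar_comp' (ψ : X ⟶ Y) (φ : Y ⟶ Z) :
    scalar (ψ ≫ φ) = (Base ψ).act (scalar φ) * scalar ψ ^ (degFr φ : ℕ) := rfl

/-- Extensionality for arrows of `C₀`: an arrow is determined by `(Base, deg_Fr, scalar)`.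
[cite: MochizukiFrdII2008, Ex 3.3 (i) p.27] -/
theorem hom_ext {φ ψ : X ⟶ Y} (h₁ : Base φ = Base ψ) (h₂ : degFr φ = degFr ψ)
    (h₃ : scalar φ = scalar ψ) : φ = ψ :=
  Hom.ext h₁ h₂ h₃

/-- The natural projection functor `C₀ → D₀`. [cite: MochizukiFrdII2008, Ex 3.3 (i) p.27] -/
def baseFunctor : C0 ⥤ D0 where
  obj X := X.base
  map φ := Base φ

/-- "If, whenever `L` is complex, the image `Im(A_L^{⊗d}) ⊆ V_K|_L` is co-angular with `A_K|_L`, then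
we shall say that `φ` is *naively co-angular*. [Thus, if `L` is real, then `φ` is always naively
co-angular.]" (FrdII Ex. 3.3 (i), p. 28) — co-angular = equal projections to `O_L^× = S¹`.
[cite: MochizukiFrdII2008, Ex 3.3 (i) p.28] -/
def IsNaivelyCoAngular (φ : X ⟶ Y) : Prop :=
  X.IsComplexObj → unitPart ℂ '' Hom.image φ = unitPart ℂ '' pullRegion Y (Base φ)

/-- An arrow with real domain is naively co-angular ("[Thus, if `L` is real, then `φ` is always
naively co-angular.]", p. 28). [cite: MochizukiFrdII2008, Ex 3.3 (i) p.28] -/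
theorem isNaivelyCoAngular_of_isRealObj (φ : X ⟶ Y) (h : X.IsRealObj) : IsNaivelyCoAngular φ := by
  intro hc
  exact absurd (h.symm.trans hc) (by decide)

end C0

end ArchFrd

end

end Literature.AlgebraicGeometry.Frobenioids
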